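import Literature.NumberTheory.GaloisCohomology.Howard2004.Thm161PrintIntendedOfEngineBricks
import Literature.NumberTheory.GaloisCohomology.Howard2004.CasselsTateSkewPairingPrintIntended
import HarnessLib

/-!
# Howard 2004: the ENGINE's typed input and its closing theorem (Thm. 1.6.1 as intended, F-161′) from the
# PRINT-AS-INTENDED Flach leaf C45.1″ `prop141_casselsTate_skewPairing_atLevel_printIntended` — proofs file

Topic `NumberTheory/GaloisCohomology/Howard2004`. THEOREMS ONLY: no definition, no named fact, no instance, no notation,
no `sorry`.  Cell `pub/bsd-print-x9` (seat x10b-p1-w7 g12, brick «C451″-GLUE» on the GO of `bsd-line-x10b-p1` LEAD g13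
(2026-08-29T13:42:01Z) after the cell referee's READING RULING REF-177 «HU-AXIS OF C45.1′»; `--supports stmt-BirchSwinnertonDyer-22642`).

WHY.  The cite-only leaf C45.1′ `prop141_casselsTate_skewPairing_atLevel` (Howard Prop. 1.4.1 / Flach + displays (i)(ii) of the
proof of Thm. 1.4.2, for every `(T^{(k)}, 𝓕(n))`, `n ∈ 𝓝^{(k)}`) is typed AS WORDED: for `n ≠ ∅` it reaches `𝓕(n)` through
Lemma 1.5.1, whose H.4 clause (self-orthogonality of the transverse slots) rests on §1.2's identification of the canonical
ring-class `L` as a MAXIMAL totally tamely ramified abelian `p`-extension (arXiv:1202.6340 p0006 L84–92) — false exactly at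
`(p, d_K) = (3, −3)` (print gap «How04-2.4.1/2.5.1@(3,−3)-units», REF-167 / REF-177).  The print-as-INTENDED twin C45.1″
`prop141_casselsTate_skewPairing_atLevel_printIntended` (lit g46, `CasselsTateSkewPairingPrintIntended.lean`) carries the two
standing guards of F-161′, `((p : ℕ) : R) ≠ 0` and `¬ p ∣ Nat.card (𝓞 K)ˣ`, after `S.SatisfiesH`.  This file re-derives BY NAME,
from C45.1″ instead of C45.1′:
* **`DVRSetting.hasLevelDecompositionsAt_of_prop141_printIntended`**, **`…hasLevelDecompositions_of_prop141_printIntended`**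
  (the α-PLUG″: the engine's typed input `HasLevelDecompositions[At]` per setting, under the two guards);
* **`DVRSetting.thm161_printIntended_of_prop141_printIntended`** (CLOSING″):
  `prop141_casselsTate_skewPairing_atLevel_printIntended → (∀ K, poitouTate_selmerStructure_duality_conj K) →
  thm161_dvrKolyvaginBound_printIntended` — the term of `thm161_printIntended_of_prop141` (p720105, x10b-p1-w2 g17) over
  the generic wrapper `thm161_printIntended_of_h159_hcheb` (p711883, LEAD g13), whose per-setting hypotheses already bind
  `hp0`/`hu`, with the ″-plug in the `hdec` slot.  (`C45.1′ → C45.1″` is lit's `…_printIntended_of_prop141`.)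

HONEST FRAMING: CONDITIONAL on the cite-only named fact C45.1″ (a hypothesis) and on Poitou–Tate duality for Selmer
structures (a binder; a kernel theorem Summits-side); the verbatim-as-worded F-161 is NOT proved; C45.1′ / C45.1″ are NOT
proved; no summit statement is proved; the Birch–Swinnerton-Dyer conjecture is not proved by any of this.
References: [Howard2004HeegnerKolyvagin] Prop. 1.4.1, Thm. 1.4.2, Lemma 1.5.1, Thm. 1.6.1 (arXiv:1202.6340 p0008 L83–L142,
p0009 L127–133, p0011 L17–58); [Flach1990]; [MilneADT2006] I Thm. 4.10.
-/

set_option autoImplicit false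

noncomputable section

open Function NumberField IsDedekindDomain Field
open scoped NumberField ContRepresentation Classical

namespace Literature.NumberTheory.GaloisCohomology.Howard2004

open Literature.NumberTheory.GaloisRepresentations
open Literature.NumberTheory.GaloisRepresentations.DiscreteGaloisModule
open Literature.NumberTheory.GaloisRepresentations.galoisCohomology
open Literature.NumberTheory.EllipticCurves

namespace DVRSetting

section AlphaPlug

variable {p : ℕ} [Fact p.Prime] {K : Type} [Field K] [NumberField K]
  {R : Type} [CommRing R] [IsDomain R] [IsDiscreteValuationRing R] [Algebra ℤ_[p] R]
  {N : ℕ → Type} [∀ k, AddCommGroup (N k)] [∀ k, TopologicalSpace (N k)]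
  [∀ k, DiscreteTopology (N k)] [∀ k, Module R (N k)]
  {Rk : ℕ → Type} [∀ k, CommRing (Rk k)] [∀ k, IsLocalRing (Rk k)] [∀ k, TopologicalSpace (Rk k)]
  [∀ k, DiscreteTopology (Rk k)] [∀ k, Algebra ℤ_[p] (Rk k)] [∀ k, Algebra R (Rk k)]
  [∀ k, Module (Rk k) (N k)] [∀ k, IsScalarTower R (Rk k) (N k)]
  {Nbar : Type} [AddCommGroup Nbar] [TopologicalSpace Nbar] [DiscreteTopology Nbar]
  [∀ k, Module (Rk k) Nbar]
  {Nq : ℕ → Finset (HeightOneSpectrum (𝓞 K)) → Type} [∀ k n, AddCommGroup (Nq k n)]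
  [∀ k n, TopologicalSpace (Nq k n)] [∀ k n, DiscreteTopology (Nq k n)]
  [∀ k n, Module (Rk k) (Nq k n)] [∀ k n, Module R (Nq k n)]
  [∀ k n, IsScalarTower R (Rk k) (Nq k n)]

/-- **(α-PLUG″) THE ENGINE'S TYPED INPUT BY NAME from the print-as-intended leaf.**  On a `DVRSetting` with H.0–H.5 and the
two standing guards of the printed proof — `(p : R) ≠ 0` and `p ∤ #𝓞_K^×` — the leaf C45.1″
`prop141_casselsTate_skewPairing_atLevel_printIntended` gives `S.HasLevelDecompositionsAt hy` (Howard's Thm. 1.4.2 for every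
`(T^{(k)}, 𝓕(n))`, `n ∈ 𝓝^{(k)}`), through `hasLevelDecompositionsAt_of_skewPairings_display`.
[cite: Howard2004HeegnerKolyvagin, Prop. 1.4.1, Thm. 1.4.2 (with proof), Lemma 1.5.1 and §1.6 ¶1 (arXiv:1202.6340 p0008 L83–L142, p0009 L127–133, p0011 L33–44)]
[cite: Flach1990, Thm. 1] -/
theorem hasLevelDecompositionsAt_of_prop141_printIntended (h141 : prop141_casselsTate_skewPairing_atLevel_printIntended)
    (S : DVRSetting p K R N Rk Nbar Nq) (hy : S.SatisfiesH) (hp0 : ((p : ℕ) : R) ≠ 0)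
    (hu : ¬ p ∣ Nat.card (𝓞 K)ˣ) : S.HasLevelDecompositionsAt hy :=
  S.hasLevelDecompositionsAt_of_skewPairings_display hy (h141 p K R N Rk Nbar Nq S hy hp0 hu)

/-- The `𝓝(𝓛^{(2k-1)})`-keyed slot `HasLevelDecompositions` (feeding `stubLength` / `stub`) from the same leaf, under the same
guards. [cite: Howard2004HeegnerKolyvagin, Prop. 1.4.1, Thm. 1.4.2 (with proof) and §1.6 ¶1 (arXiv:1202.6340 p0008 L83–L142, p0011 L33–44)]
[cite: Flach1990, Thm. 1] -/
theorem hasLevelDecompositions_of_prop141_printIntended (h141 : prop141_casselsTate_skewPairing_atLevel_printIntended)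
    (S : DVRSetting p K R N Rk Nbar Nq) (hy : S.SatisfiesH) (hp0 : ((p : ℕ) : R) ≠ 0)
    (hu : ¬ p ∣ Nat.card (𝓞 K)ˣ) : S.HasLevelDecompositions hy :=
  (S.hasLevelDecompositionsAt_of_prop141_printIntended h141 hy hp0 hu).toHasLevelDecompositions

end AlphaPlug

/-- **Howard 2004, Thm. 1.6.1 as intended by its printed proof (F-161′), from the print-as-INTENDED leaf C45.1″ and
Poitou–Tate duality (CLOSING″).**  For every `DVRSetting` `S` with H.0–H.5, every Kolyvagin system `κ`, under `(p : R) ≠ 0`,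
`p ∤ #𝓞_K^×`, `𝓛_s(T) ⊂ 𝓛` (`s ≫ 0`) and `κ_1 ≠ 0`: `H¹_𝓕(K, T)` is free of rank one, `H¹_𝓕(K, A) ≅ 𝒟 ⊕ M ⊕ M`,
`len M ≤ len(H¹_𝓕(K,T)/Rκ_1)` — the term of `thm161_printIntended_of_prop141` (p720105) run over the generic wrapper
`thm161_printIntended_of_h159_hcheb`, whose per-setting hypotheses carry `hp0`/`hu`, with
`hasLevelDecompositions[At]_of_prop141_printIntended h141 hy hp0 hu` in the decomposition slots; everything else by name as there
(`exists_eigenLengths`, `engine_hdis`, `engine_gd_dich_of_eigenlines` ∘ `residual_eigenline_letters`, `engine_hpar_of_letters`,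
`engine_h159_of_units` with the datum letters, `engine_hchebI/II` with `Automorphic.chebotarev_artinRep_of_galoisSide`).
[cite: Howard2004HeegnerKolyvagin, Thm. 1.6.1 with proof (arXiv Thm. 2.6.1, p. 11 L17 – p. 12 L55), Prop. 1.4.1 / Thm. 1.4.2, Lemma 1.5.1]
[cite: MilneADT2006, Ch. I Thm. 4.10] -/
theorem thm161_printIntended_of_prop141_printIntended (h141 : prop141_casselsTate_skewPairing_atLevel_printIntended)
    (hPT : ∀ (K : Type) [Field K] [NumberField K], poitouTate_selmerStructure_duality_conj K) :
    thm161_dvrKolyvaginBound_printIntended := by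
  refine thm161_printIntended_of_h159_hcheb ?_
  intro p _ K _ _ R _ _ _ _ N _ _ _ _ Rk _ _ _ _ _ _ _ _ Nbar _ _ _ _ Nq _ _ _ _ _ _ _ S _ hy _ _ _ _ hp0 hu hL _
  letI : ∀ k, Module R (galoisCohomology (S.T.ρ k) 1) :=
    fun k => galoisCohomology.moduleH1 (S.T.ρ k) (S.T.hlin k)
  letI : ∀ (k : ℕ) (v : Place K), Module R (galoisCohomology ((S.T.ρ k).toLocal v) 1) :=
    fun k v => galoisCohomology.moduleH1 ((S.T.ρ k).toLocal v) ((S.T.hlin k).restrictField (Place.Completion v))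
  haveI : Finite Nbar := S.finite_residual hy
  haveI : ∀ k, Finite (N k) := fun k => S.finite_level hy k
  have hdec : S.HasLevelDecompositions hy := S.hasLevelDecompositions_of_prop141_printIntended h141 hy hp0 hu
  -- Prop. 1.1.9 at the residual level (R3): `F̄_k(v) ∩ H¹_tr(K_v, T̄) = 0` at every engine prime
  have HDIS : ∀ (k : ℕ) (v : HeightOneSpectrum (𝓞 K)) (hv : v ∈ S.enginePrimes k),
      Disjoint (((hy.h1 k).1.propagateStructure (S.t k).cond) (Sum.inr v))
        ((transverseStructure p S.ρbar S.jbar) (Sum.inr v)) :=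
    fun k v hv => S.engine_hdis hy hu k v hv
  -- Lemma 1.5.3 at the residual level (R7): (GD-line)± and (DICH)± at every engine prime off `n`
  have hGD := fun (k : ℕ) (n : Finset (HeightOneSpectrum (𝓞 K))) (hn : ↑n ⊆ S.enginePrimes k) =>
    S.engine_gd_dich_of_eigenlines hy k hu (hPT K) hn (S.residual_eigenline_letters hy k hu).1 (S.residual_eigenline_letters hy k hu).2.1
      (S.residual_eigenline_letters hy k hu).2.2.1 (S.residual_eigenline_letters hy k hu).2.2.2.1 (S.residual_eigenline_letters hy k hu).2.2.2.2.1
      (S.residual_eigenline_letters hy k hu).2.2.2.2.2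
  refine ⟨hdec, S.hasLevelDecompositionsAt_of_prop141_printIntended h141 hy hp0 hu, ?_, ?_⟩
  · -- H159 = Prop. 1.5.9 in the engine shape (Lemma 1.5.3's parity `hpar` from the eigen-lengths and R7)
    obtain ⟨ρp, ρm, hρp, hρm⟩ := S.exists_eigenLengths hy hdec
    exact S.engine_h159_of_units hy hdec hu (poitouTate_selmerStructure_duality_of_conj (hPT K)) S.datum_hI (S.datum_hφ hy) S.datum_hφI (S.datum_hφΛ hy)
      (S.datum_hδ_of_hχ hy (S.datum_hχ hy))
      (S.engine_hpar_of_letters hy ρp ρm hρp hρm HDIS hGD)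
  · -- HCHEB = Lemma 1.6.2 (Chebotarev) + Lemma 1.5.3, Cases i / ii of Lemma 1.6.4
    intro ρp ρm hρp hρm
    exact ⟨S.engine_hchebI hy Automorphic.chebotarev_artinRep_of_galoisSide hp0 hL ρp ρm
        (fun k n hn => (hρp k n hn).trans rfl) (fun k n hn => (hρm k n hn).trans rfl) (fun k v hv => HDIS k v hv)
        (fun k n hn => (hGD k n hn).1) (fun k n hn => (hGD k n hn).2.2.1) (fun k n hn => (hGD k n hn).2.1)
        (fun k n hn => (hGD k n hn).2.2.2),
      S.engine_hchebII hy Automorphic.chebotarev_artinRep_of_galoisSide hp0 hL ρp ρm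
        (fun k n hn => (hρp k n hn).trans rfl) (fun k n hn => (hρm k n hn).trans rfl) (fun k v hv => HDIS k v hv)
        (fun k n hn => (hGD k n hn).1) (fun k n hn => (hGD k n hn).2.2.1) (fun k n hn => (hGD k n hn).2.1)
        (fun k n hn => (hGD k n hn).2.2.2)⟩

end DVRSetting

end Literature.NumberTheory.GaloisCohomology.Howard2004

end
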